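import Literature.Topology.FourManifolds.GompfStraighteningExistence
import Literature.Topology.FourManifolds.GompfFramingClasses
import HarnessLib

/-!
# The axis twist of a straightening

Fifth infrastructure file for the framed form of Gompf's Theorem 2.1
(`Literature.Topology.FourManifolds.gompf2010_framedTwist`; R. Gompf, *More Cappell–Shaneson
spheres are standard*, Algebr. Geom. Topol. 10 (2010)). Gompf, §4 after Def. 4.1 and ¶3: the two
straightenings of `A` differ by the generator of `π₁(GL(V)) = ℤ/2`; "the isotopies will differ by
a full twist in the normal bundle of the curve" `α`. Given a straightening `S` of `A` with exactly
linear germs (`Straightening A`, `GompfFramedTwistTransport.lean`), we construct a second one,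
**`S.axisTwist`**, by precomposing the (reparametrised) diffeotopy of `S` with the **axis twist**:
the based diffeotopy of `T³` which, in exponential coordinates, rotates the normal plane of the
first coordinate axis by the angle `2π λ(t) χ(v₁² + v₂²)` (`λ = Real.smoothTransition`, `χ` a
bump equal to `1` near the axis and `0` off a thin tube) — a full turn of the normal bundle of the
first coordinate circle, supported in a tube around it. Its germs at the base point multiply the
linear parts of `S` pointwise by the rotation `Rₓ(2π λ(t))`, so the framing path of `S.axisTwist`
is that of `S.reparam` times the conjugated full turn `A⁻¹ Rₓ(2π μ(θ)) A`
(`Straightening.axisTwist_path_toFun`) — the relation under which `GompfFramingClasses.lean` shows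
that the two paths lie in the two different straightening classes.

Contents (all proved, no named facts):

* `Literature.Topology.FourManifolds.logTAlt`, `Literature.Topology.FourManifolds.torusSlitAlt` —
  the second logarithmic chart of `T³` (branch cut of the first coordinate moved to `z₁ = 1`);
* `Literature.Topology.FourManifolds.contMDiff_torusPush_uncurry_tube`,
  `Literature.Topology.FourManifolds.Diffeotopy.torusExtendTube` — **extension through
  exponential coordinates of tube-supported, axis-equivariant diffeotopies of `ℝ³`** (stages
  commuting with the translations along `e₀` and equal to the identity where `v₁² + v₂² ≥ R²`,
  `R < π`), complementing the ball-supported `Diffeotopy.torusExtend` of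
  `GompfStraighteningExistence.lean`;
* `Literature.Topology.FourManifolds.tubeRot`, `axisBump`, `axisAngle`, `axisRotFun`,
  `Literature.Topology.FourManifolds.axisRotDiffeotopy` (on `ℝ³`, with the explicit inverse
  "rotate back by the same angle") and `Literature.Topology.FourManifolds.axisTwistDiffeotopy`
  (on `T³`): exactly the rotation `Rₓ(2π λ(t))` in exponential coordinates where
  `v₁² + v₂² < 1/4`, the identity where `v₁² + v₂² ≥ 1/2`, and at `t = 1` the identity on both
  regions (`axisRotFun_one_of_le`, `axisRotFun_of_half_le`);
* `Literature.Topology.FourManifolds.Straightening.reparam` (time reparametrised by `λ`, so that the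
  inverse linear parts are bounded) and **`Literature.Topology.FourManifolds.Straightening.axisTwist`**,
  with `Straightening.axisTwist_path_toFun`;
* consequences with `GompfFramingClasses.lean`:
  `Literature.Topology.FourManifolds.Straightening.homotopic_reparam_or_axisTwist` (every framing
  path of `A` lies in the class of `S.reparam.path` or of `S.axisTwist.path`),
  `Literature.Topology.FourManifolds.exists_straightening_homotopic` and the **normal form of all of
  Gompf's framed spheres**,
  `Literature.Topology.FourManifolds.exists_straightening_nonempty_diffeomorph_prodSphere`: for
  every `A ∈ SL(3, ℤ)` and every framing path `γ`, `gompfSphere A γ` is diffeomorphic to the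
  product-framed surgery `S.prodSphere` of a straightened mapping torus (monodromy the identity
  near the base point) for some straightening `S` of `A` — Gompf's "`X^σ_A`, `σ` one of the two
  straightenings" (§4 ¶2) made concrete for both classes.

## References

* R. E. Gompf, *More Cappell–Shaneson spheres are standard*, Algebr. Geom. Topol. 10 (2010)
  1665–1681: §4 Def. 4.1, the sentence following it, ¶2 and ¶3. [GompfAGT2010]
* M. W. Hirsch, *Differential Topology*, GTM 33 (1976), Ch. 8 §1 (extension of compactly
  supported diffeotopies), §3. [Hirsch1976]
-/

open scoped Manifold ContDiff Topology Real
open Set Function Metric Filter Complex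
open Literature.AlgebraicTopology.FundamentalGroup (rotX)

noncomputable section

namespace Literature.Topology.FourManifolds

/-- Local notation: `𝔼 n` is the model Euclidean space `EuclideanSpace ℝ (Fin n)`. -/
local notation "𝔼 " n:arg => EuclideanSpace ℝ (Fin n)

/-- Local notation: the model with corners `𝓣 = (𝓡 1).prod ((𝓡 1).prod (𝓡 1))` of `ThreeTorus`. -/
local notation "𝓣" =>
  (ModelWithCorners.prod (𝓡 1) (ModelWithCorners.prod (𝓡 1) (𝓡 1)))

attribute [local instance] finrank_real_complex_fact'

/-! ### The axis direction and the second logarithmic chart -/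

section AltChart

/-- The first coordinate vector `e₀` of `ℝ³` (the direction of the axis). [folklore] -/
def axisVec : 𝔼 3 := EuclideanSpace.single 0 1

/-- `e₀ 0 = 1`. [folklore] -/
@[simp] theorem axisVec_apply_zero : axisVec 0 = 1 := by simp [axisVec]

/-- `e₀ 1 = 0`. [folklore] -/
@[simp] theorem axisVec_apply_one : axisVec 1 = 0 := by simp [axisVec]

/-- `e₀ 2 = 0`. [folklore] -/
@[simp] theorem axisVec_apply_two : axisVec 2 = 0 := by simp [axisVec]

/-- `expT (u + c e₀) = expT u` whenever `e^{ic} = 1`. [folklore] -/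
theorem expT_add_smul_axisVec (u : 𝔼 3) {c : ℝ} (hc : Circle.exp c = 1) : expT (u + c • axisVec) = expT u := by
  apply torusCoord_injective
  ext j : 1
  rw [torusCoord_expT, torusCoord_expT]
  fin_cases j
  · show Circle.exp ((u + c • axisVec) 0) = Circle.exp (u 0)
    rw [PiLp.add_apply, PiLp.smul_apply, axisVec_apply_zero, smul_eq_mul, mul_one, Circle.exp_add, hc,
      mul_one]
  · show Circle.exp ((u + c • axisVec) 1) = Circle.exp (u 1)
    rw [PiLp.add_apply, PiLp.smul_apply, axisVec_apply_one, smul_zero, add_zero]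
  · show Circle.exp ((u + c • axisVec) 2) = Circle.exp (u 2)
    rw [PiLp.add_apply, PiLp.smul_apply, axisVec_apply_two, smul_zero, add_zero]

/-- `expT (u + 2πk e₀) = expT u`. [folklore] -/
theorem expT_add_two_pi_mul_smul_axisVec (u : 𝔼 3) (k : ℤ) : expT (u + (2 * π * k) • axisVec) = expT u :=
  expT_add_smul_axisVec u (Circle.exp_two_pi_mul_int k)

/-- **Logarithms of exponentials with two small coordinates**: if `|u₁|, |u₂| < π` then
`logT (expT u) = u + 2πk e₀` for some `k ∈ ℤ`. [folklore] -/
theorem exists_logT_expT_eq_add (u : 𝔼 3) (h1 : |u 1| < π) (h2 : |u 2| < π) :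
    ∃ k : ℤ, logT (expT u) = u + (2 * π * k) • axisVec := by
  obtain ⟨m, hm⟩ := Circle.exp_eq_exp.1 (Circle.exp_arg (Circle.exp (u 0)))
  refine ⟨m, ?_⟩
  ext j
  rw [PiLp.add_apply, PiLp.smul_apply, logT_apply, torusCoord_expT, smul_eq_mul]
  fin_cases j
  · show arg (Circle.exp (u 0) : ℂ) = u 0 + 2 * π * m * axisVec 0
    rw [hm, axisVec_apply_zero]
    ring
  · show arg (Circle.exp (u 1) : ℂ) = u 1 + 2 * π * m * axisVec 1
    rw [Circle.arg_exp (abs_lt.1 h1).1 (abs_lt.1 h1).2.le, axisVec_apply_one, mul_zero, add_zero]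
  · show arg (Circle.exp (u 2) : ℂ) = u 2 + 2 * π * m * axisVec 2
    rw [Circle.arg_exp (abs_lt.1 h2).1 (abs_lt.1 h2).2.le, axisVec_apply_two, mul_zero, add_zero]

/-- **The second logarithmic chart**: principal arguments of the last two coordinates, and
`arg (-z₀) + π` for the first (branch cut at `z₀ = 1` instead of `z₀ = -1`). [folklore] -/
def logTAlt (z : ThreeTorus) : 𝔼 3 :=
  WithLp.toLp 2 fun j ↦ if j = 0 then arg (-(torusCoord z 0 : ℂ)) + π else arg (torusCoord z j : ℂ)

/-- The open set where the second chart is smooth: `z₀ ≠ 1`, `z₁, z₂ ≠ -1`. [folklore] -/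
def torusSlitAlt : Set ThreeTorus :=
  {z | -(torusCoord z 0 : ℂ) ∈ slitPlane} ∩
    ({z | (torusCoord z 1 : ℂ) ∈ slitPlane} ∩ {z | (torusCoord z 2 : ℂ) ∈ slitPlane})

/-- `torusSlitAlt` is open. [folklore] -/
theorem isOpen_torusSlitAlt : IsOpen torusSlitAlt :=
  (isOpen_slitPlane.preimage (contMDiff_coe_torusCoord 0).continuous.neg).inter
    ((isOpen_slitPlane.preimage (contMDiff_coe_torusCoord 1).continuous).inter
      (isOpen_slitPlane.preimage (contMDiff_coe_torusCoord 2).continuous))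

/-- **The second chart is smooth on `torusSlitAlt`.** [folklore] -/
theorem contMDiffOn_logTAlt : ContMDiffOn 𝓣 𝓘(ℝ, 𝔼 3) ∞ logTAlt torusSlitAlt := by
  have h : ContMDiffOn 𝓣 𝓘(ℝ, Fin 3 → ℝ) ∞
      (fun z j ↦ if j = 0 then arg (-(torusCoord z 0 : ℂ)) + π else arg (torusCoord z j : ℂ))
      torusSlitAlt := by
    rw [contMDiffOn_pi_space]
    intro j z hz
    have hA : ∀ i : Fin 3, (torusCoord z i : ℂ) ∈ slitPlane →
        ContMDiffWithinAt 𝓣 𝓘(ℝ, ℝ) ∞ (fun z : ThreeTorus ↦ arg (torusCoord z i : ℂ))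
          torusSlitAlt z := fun i hi ↦
      ((contDiffAt_arg hi).comp_contMDiffAt (f := fun z : ThreeTorus ↦ (torusCoord z i : ℂ))
        (contMDiff_coe_torusCoord i).contMDiffAt).contMDiffWithinAt
    fin_cases j
    · simp only [Fin.zero_eta, if_true]
      have h1 : ContMDiffAt 𝓣 𝓘(ℝ, ℝ) ∞ (fun z : ThreeTorus ↦ arg (-(torusCoord z 0 : ℂ))) z :=
        (contDiffAt_arg hz.1).comp_contMDiffAt (f := fun z : ThreeTorus ↦ -(torusCoord z 0 : ℂ))
          (contMDiff_coe_torusCoord 0).neg.contMDiffAt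
      exact (h1.add contMDiffAt_const).contMDiffWithinAt
    · simpa using hA 1 hz.2.1
    · simpa using hA 2 hz.2.2
  have hE : ContMDiff 𝓘(ℝ, Fin 3 → ℝ) 𝓘(ℝ, 𝔼 3) ∞
      ((EuclideanSpace.equiv (Fin 3) ℝ).symm : (Fin 3 → ℝ) →L[ℝ] 𝔼 3) :=
    ContinuousLinearMap.contMDiff _
  exact (hE.comp_contMDiffOn h).congr fun z _ ↦ rfl

/-- For `w` on the unit circle, `e^{i(arg(-w) + π)} = w` and `e^{i arg w} = w`, so the difference
of the two angles exponentiates to `1`. [folklore] -/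
theorem circleExp_argAlt_sub_arg (w : Circle) :
    Circle.exp (arg (-(w : ℂ)) + π - arg (w : ℂ)) = 1 := by
  apply Subtype.ext
  rw [Circle.coe_exp, Circle.coe_one]
  have hw : (w : ℂ) ≠ 0 := Circle.coe_ne_zero w
  have hnw : ‖-(w : ℂ)‖ = 1 := by rw [norm_neg, Circle.norm_coe]
  have h1 : Complex.exp (↑(arg (-(w : ℂ))) * I) = -(w : ℂ) := by
    have := norm_mul_exp_arg_mul_I (-(w : ℂ))
    rwa [hnw, Complex.ofReal_one, one_mul] at this
  have h2 : Complex.exp (↑(arg (w : ℂ)) * I) = (w : ℂ) := by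
    have := norm_mul_exp_arg_mul_I (w : ℂ)
    rwa [Circle.norm_coe, Complex.ofReal_one, one_mul] at this
  rw [show (↑(arg (-(w : ℂ)) + π - arg (w : ℂ)) : ℂ) * I =
      ↑(arg (-(w : ℂ))) * I + ↑π * I - ↑(arg (w : ℂ)) * I by push_cast; ring,
    Complex.exp_sub, Complex.exp_add, h1, h2, Complex.exp_pi_mul_I]
  field_simp

/-- **The two charts differ by a translation along the axis**:
`logTAlt z = logT z + (arg(-z₀) + π - arg z₀) e₀`. [folklore] -/
theorem logTAlt_eq (z : ThreeTorus) :
    logTAlt z = logT z + (arg (-(torusCoord z 0 : ℂ)) + π - arg (torusCoord z 0 : ℂ)) • axisVec := by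
  ext j
  rw [PiLp.add_apply, PiLp.smul_apply, logT_apply, smul_eq_mul]
  fin_cases j
  · simp [logTAlt]
  · simp [logTAlt]
  · simp [logTAlt]

end AltChart

/-! ### Pushing tube-supported, axis-equivariant maps to `T³` -/

section TubePush

variable {R : ℝ}

/-- Off `expT (K)`, `K = {|v₀| ≤ π, v₁² + v₂² ≤ R²}`, the push of a map that is the identity where
`v₁² + v₂² ≥ R²` is the identity. [folklore] -/
theorem torusPush_of_not_mem_tube {F : 𝔼 3 → 𝔼 3} (hF : ∀ v : 𝔼 3, R ^ 2 ≤ v 1 ^ 2 + v 2 ^ 2 → F v = v)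
    {z : ThreeTorus}
    (hz : z ∉ expT '' {v : 𝔼 3 | |v 0| ≤ π ∧ v 1 ^ 2 + v 2 ^ 2 ≤ R ^ 2}) : torusPush F z = z := by
  have h : R ^ 2 ≤ (logT z) 1 ^ 2 + (logT z) 2 ^ 2 := by
    by_contra h
    exact hz ⟨logT z, ⟨abs_le.2 ⟨(logT_apply_mem z 0).1.le, (logT_apply_mem z 0).2⟩,
      (not_le.1 h).le⟩, expT_logT z⟩
  rw [torusPush, hF _ h, expT_logT]

/-- The tube set `K` is compact. [folklore] -/
theorem isCompact_tubeBox (R : ℝ) :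
    IsCompact {v : 𝔼 3 | |v 0| ≤ π ∧ v 1 ^ 2 + v 2 ^ 2 ≤ R ^ 2} := by
  refine Metric.isCompact_of_isClosed_isBounded ?_ ?_
  · have h0 : Continuous fun v : 𝔼 3 ↦ |v 0| :=
      (EuclideanSpace.proj (𝕜 := ℝ) (0 : Fin 3)).continuous.abs
    have h12 : Continuous fun v : 𝔼 3 ↦ v 1 ^ 2 + v 2 ^ 2 :=
      ((EuclideanSpace.proj (𝕜 := ℝ) (1 : Fin 3)).continuous.pow 2).add
        ((EuclideanSpace.proj (𝕜 := ℝ) (2 : Fin 3)).continuous.pow 2)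
    exact (isClosed_le h0 continuous_const).inter (isClosed_le h12 continuous_const)
  · refine (Metric.isBounded_closedBall (x := (0 : 𝔼 3)) (r := 2 * (π + |R| + 1))).subset ?_
    rintro v ⟨h0, h12⟩
    rw [mem_closedBall_zero_iff]
    have hR : R ^ 2 = |R| ^ 2 := (sq_abs R).symm
    have h1 : |v 1| < π + |R| + 1 := by
      have : v 1 ^ 2 < (π + |R| + 1) ^ 2 := by nlinarith [sq_nonneg (v 2), abs_nonneg R, Real.pi_pos]
      exact abs_lt_of_sq_lt_sq this (by positivity)
    have h2 : |v 2| < π + |R| + 1 := by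
      have : v 2 ^ 2 < (π + |R| + 1) ^ 2 := by nlinarith [sq_nonneg (v 1), abs_nonneg R, Real.pi_pos]
      exact abs_lt_of_sq_lt_sq this (by positivity)
    have h0' : |v 0| < π + |R| + 1 := by linarith [abs_nonneg R]
    exact (norm_lt_two_mul_of_abs_lt (R := π + |R| + 1) fun i ↦ by
      fin_cases i <;> assumption).le

/-- **Joint smoothness of the pushed family, tube-supported axis-equivariant case.** If
`Φ : ℝ × ℝ³ → ℝ³` is jointly smooth, every `Φ_t` commutes with the translations along `e₀` and is
the identity where `v₁² + v₂² ≥ R²` (`R < π`), then `(t, z) ↦ push (Φ_t) z` is jointly smooth on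
`ℝ × T³`: near the slit torus it is `expT ∘ Φ ∘ (id × logT)`, near the second slit torus it is
`expT ∘ Φ ∘ (id × logTAlt)` (by equivariance), and elsewhere it is the identity. [cite: Hirsch1976, Ch. 8 §3, proof of Thm 3.1 (inserting a bump function)] -/
theorem contMDiff_torusPush_uncurry_tube {Φ : ℝ → 𝔼 3 → 𝔼 3}
    (hΦ : ContMDiff (𝓘(ℝ, ℝ).prod 𝓘(ℝ, 𝔼 3)) 𝓘(ℝ, 𝔼 3) ∞ (uncurry Φ)) (hR : R < π) (hR0 : 0 < R)
    (hfix : ∀ t (v : 𝔼 3), R ^ 2 ≤ v 1 ^ 2 + v 2 ^ 2 → Φ t v = v)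
    (hper : ∀ t (v : 𝔼 3) (c : ℝ), Φ t (v + c • axisVec) = Φ t v + c • axisVec) :
    ContMDiff (𝓘(ℝ, ℝ).prod 𝓣) 𝓣 ∞ (uncurry fun t z ↦ torusPush (Φ t) z) := by
  rintro ⟨t, z⟩
  by_cases hz : z ∈ torusSlit
  · have h0 : ContMDiffAt 𝓣 𝓘(ℝ, 𝔼 3) ∞ logT z :=
      contMDiffOn_logT.contMDiffAt (isOpen_torusSlit.mem_nhds hz)
    have h0' : ContMDiffAt (𝓘(ℝ, ℝ).prod 𝓣) 𝓘(ℝ, 𝔼 3) ∞ (fun q : ℝ × ThreeTorus ↦ logT q.2) (t, z) :=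
      h0.comp_of_eq (contMDiffAt_snd (p := (t, z))) rfl
    have h1 : ContMDiffAt (𝓘(ℝ, ℝ).prod 𝓣) (𝓘(ℝ, ℝ).prod 𝓘(ℝ, 𝔼 3)) ∞
        (fun q : ℝ × ThreeTorus ↦ (q.1, logT q.2)) (t, z) :=
      contMDiffAt_fst.prodMk h0'
    have h2 : ContMDiffAt (𝓘(ℝ, ℝ).prod 𝓣) 𝓘(ℝ, 𝔼 3) ∞
        (fun q : ℝ × ThreeTorus ↦ Φ q.1 (logT q.2)) (t, z) :=
      hΦ.contMDiffAt.comp (t, z) h1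
    exact contMDiff_expT.contMDiffAt.comp (t, z) h2
  by_cases hV : z ∈ expT '' {v : 𝔼 3 | |v 0| ≤ π ∧ v 1 ^ 2 + v 2 ^ 2 ≤ R ^ 2}
  · -- `z₀ = -1`: use the second chart
    obtain ⟨v, ⟨-, hv12⟩, rfl⟩ := hV
    have hRπ : R ^ 2 < π ^ 2 := by nlinarith
    have hv1 : |v 1| < π := by
      have : v 1 ^ 2 < π ^ 2 := by nlinarith [sq_nonneg (v 2)]
      exact abs_lt_of_sq_lt_sq this Real.pi_pos.le
    have hv2 : |v 2| < π := by
      have : v 2 ^ 2 < π ^ 2 := by nlinarith [sq_nonneg (v 1)]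
      exact abs_lt_of_sq_lt_sq this Real.pi_pos.le
    have hslit : ∀ j : Fin 3, |v j| < π → (torusCoord (expT v) j : ℂ) ∈ slitPlane := fun j hj ↦ by
      rw [torusCoord_expT, mem_slitPlane_iff_arg, Circle.arg_exp (abs_lt.1 hj).1 (abs_lt.1 hj).2.le]
      exact ⟨(abs_lt.1 hj).2.ne, Circle.coe_ne_zero _⟩
    have hz0 : (torusCoord (expT v) 0 : ℂ) = -1 := by
      by_contra h
      exact hz fun j ↦ by
        fin_cases j
        · exact mem_slitPlane_of_norm_eq_one (Circle.norm_coe _) h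
        · exact hslit 1 hv1
        · exact hslit 2 hv2
    have hzA : expT v ∈ torusSlitAlt :=
      ⟨by show -(torusCoord (expT v) 0 : ℂ) ∈ slitPlane; rw [hz0, neg_neg]; exact one_mem_slitPlane,
        hslit 1 hv1, hslit 2 hv2⟩
    -- local formula through the second chart
    have hev : (uncurry fun t z ↦ torusPush (Φ t) z) =ᶠ[𝓝 (t, expT v)]
        fun q : ℝ × ThreeTorus ↦ expT (Φ q.1 (logTAlt q.2)) := by
      filter_upwards [prod_mem_nhds Filter.univ_mem (isOpen_torusSlitAlt.mem_nhds hzA)] with q hq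
      show torusPush (Φ q.1) q.2 = expT (Φ q.1 (logTAlt q.2))
      rw [torusPush, logTAlt_eq, hper, expT_add_smul_axisVec _ (circleExp_argAlt_sub_arg _)]
    refine ContMDiffAt.congr_of_eventuallyEq ?_ hev
    have h0 : ContMDiffAt 𝓣 𝓘(ℝ, 𝔼 3) ∞ logTAlt (expT v) :=
      contMDiffOn_logTAlt.contMDiffAt (isOpen_torusSlitAlt.mem_nhds hzA)
    have h0' : ContMDiffAt (𝓘(ℝ, ℝ).prod 𝓣) 𝓘(ℝ, 𝔼 3) ∞ (fun q : ℝ × ThreeTorus ↦ logTAlt q.2)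
        (t, expT v) :=
      h0.comp_of_eq (contMDiffAt_snd (p := (t, expT v))) rfl
    have h1 : ContMDiffAt (𝓘(ℝ, ℝ).prod 𝓣) (𝓘(ℝ, ℝ).prod 𝓘(ℝ, 𝔼 3)) ∞
        (fun q : ℝ × ThreeTorus ↦ (q.1, logTAlt q.2)) (t, expT v) :=
      contMDiffAt_fst.prodMk h0'
    have h2 : ContMDiffAt (𝓘(ℝ, ℝ).prod 𝓣) 𝓘(ℝ, 𝔼 3) ∞
        (fun q : ℝ × ThreeTorus ↦ Φ q.1 (logTAlt q.2)) (t, expT v) :=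
      hΦ.contMDiffAt.comp (t, expT v) h1
    exact contMDiff_expT.contMDiffAt.comp (t, expT v) h2
  · -- far from the tube: the identity
    have hK : IsClosed (expT '' {v : 𝔼 3 | |v 0| ≤ π ∧ v 1 ^ 2 + v 2 ^ 2 ≤ R ^ 2}) :=
      ((isCompact_tubeBox R).image continuous_expT).isClosed
    have hev : (uncurry fun t z ↦ torusPush (Φ t) z) =ᶠ[𝓝 (t, z)] fun q ↦ q.2 := by
      filter_upwards [prod_mem_nhds Filter.univ_mem (hK.isOpen_compl.mem_nhds hV)] with q hq
      exact torusPush_of_not_mem_tube (hfix q.1) hq.2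
    exact contMDiffAt_snd.congr_of_eventuallyEq hev

/-- **Pushes compose like the maps, tube-supported case**: if `F` is the identity where
`v₁² + v₂² ≥ R²` and preserves the open tube `v₁² + v₂² < R²` (`0 < R < π`), `G` is
axis-equivariant and `G ∘ F = id`, then `push G ∘ push F = id`. [folklore] -/
theorem torusPush_torusPush_tube {F G : 𝔼 3 → 𝔼 3} (hR : R < π) (hR0 : 0 < R)
    (hF : ∀ v : 𝔼 3, R ^ 2 ≤ v 1 ^ 2 + v 2 ^ 2 → F v = v)
    (hball : ∀ v : 𝔼 3, v 1 ^ 2 + v 2 ^ 2 < R ^ 2 → (F v) 1 ^ 2 + (F v) 2 ^ 2 < R ^ 2)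
    (hperG : ∀ (v : 𝔼 3) (c : ℝ), G (v + c • axisVec) = G v + c • axisVec) (hGF : ∀ v, G (F v) = v)
    (z : ThreeTorus) : torusPush G (torusPush F z) = z := by
  by_cases h : R ^ 2 ≤ (logT z) 1 ^ 2 + (logT z) 2 ^ 2
  · have hG : G (logT z) = logT z := by
      conv_lhs => rw [← hF _ h]
      exact hGF _
    rw [torusPush, torusPush, hF _ h, expT_logT, hG, expT_logT]
  · have hu := hball _ (not_le.1 h)
    have hu1 : |F (logT z) 1| < π := by
      have : (F (logT z)) 1 ^ 2 < π ^ 2 := by nlinarith [sq_nonneg ((F (logT z)) 2)]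
      exact abs_lt_of_sq_lt_sq this Real.pi_pos.le
    have hu2 : |F (logT z) 2| < π := by
      have : (F (logT z)) 2 ^ 2 < π ^ 2 := by nlinarith [sq_nonneg ((F (logT z)) 1)]
      exact abs_lt_of_sq_lt_sq this Real.pi_pos.le
    obtain ⟨k, hk⟩ := exists_logT_expT_eq_add (F (logT z)) hu1 hu2
    rw [torusPush, torusPush, hk, hperG, hGF, expT_add_two_pi_mul_smul_axisVec, expT_logT]

namespace Diffeotopy

variable (D : Diffeotopy 𝓘(ℝ, 𝔼 3) (𝔼 3)) (hR : R < π) (hR0 : 0 < R)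
  (hfix : ∀ t (v : 𝔼 3), R ^ 2 ≤ v 1 ^ 2 + v 2 ^ 2 → D.toFun t v = v)
  (hper : ∀ t (v : 𝔼 3) (c : ℝ), D.toFun t (v + c • axisVec) = D.toFun t v + c • axisVec)
  (hball : ∀ t (v : 𝔼 3), v 1 ^ 2 + v 2 ^ 2 < R ^ 2 →
    (D.toFun t v) 1 ^ 2 + (D.toFun t v) 2 ^ 2 < R ^ 2)

include hfix in
/-- The inverse stages are the identity off the tube as well. [folklore] -/
theorem invFun_eq_self_of_toFun_tube (t : ℝ) (v : 𝔼 3) (hv : R ^ 2 ≤ v 1 ^ 2 + v 2 ^ 2) :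
    D.invFun t v = v := by
  conv_lhs => rw [← hfix t v hv]
  exact D.invFun_toFun t v

include hper in
/-- The inverse stages are axis-equivariant as well. [folklore] -/
theorem invFun_add_smul_axisVec (t : ℝ) (v : 𝔼 3) (c : ℝ) :
    D.invFun t (v + c • axisVec) = D.invFun t v + c • axisVec := by
  apply D.toFun_injective t
  rw [D.toFun_invFun, hper, D.toFun_invFun]

include hfix in
/-- The inverse stages preserve the open tube as well. [folklore] -/
theorem invFun_tube (t : ℝ) (v : 𝔼 3) (hv : v 1 ^ 2 + v 2 ^ 2 < R ^ 2) :
    (D.invFun t v) 1 ^ 2 + (D.invFun t v) 2 ^ 2 < R ^ 2 := by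
  by_contra h
  have h1 : D.toFun t (D.invFun t v) = D.invFun t v := hfix t _ (not_lt.1 h)
  rw [D.toFun_invFun] at h1
  rw [← h1] at h
  exact h hv

/-- **Extension through exponential coordinates of a tube-supported, axis-equivariant diffeotopy
of `ℝ³`** to a diffeotopy of `T³`. [cite: Hirsch1976, Ch. 8 §3, proof of Thm 3.1 (inserting a bump function)] -/
def torusExtendTube : Diffeotopy 𝓣 ThreeTorus :=
  Diffeotopy.mk' 𝓣 (fun t ↦ torusPush (D.toFun t)) (fun t ↦ torusPush (D.invFun t))
    (contMDiff_torusPush_uncurry_tube D.contMDiff_uncurry_toFun hR hR0 hfix hper)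
    (contMDiff_torusPush_uncurry_tube D.contMDiff_uncurry_invFun hR hR0
      (D.invFun_eq_self_of_toFun_tube hfix) (D.invFun_add_smul_axisVec hper))
    (fun t z ↦ torusPush_torusPush_tube hR hR0 (hfix t) (hball t) (D.invFun_add_smul_axisVec hper t)
      (D.invFun_toFun t) z)
    (fun t z ↦ torusPush_torusPush_tube hR hR0 (D.invFun_eq_self_of_toFun_tube hfix t)
      (D.invFun_tube hfix t) (hper t) (D.toFun_invFun t) z)
    (by rw [D.toFun_zero, torusPush_id])

/-- Stages of the tube extension (definitional). [folklore] -/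
@[simp] theorem torusExtendTube_toFun (t : ℝ) :
    (D.torusExtendTube hR hR0 hfix hper hball).toFun t = torusPush (D.toFun t) := rfl

/-- Inverse stages of the tube extension (definitional). [folklore] -/
@[simp] theorem torusExtendTube_invFun (t : ℝ) :
    (D.torusExtendTube hR hR0 hfix hper hball).invFun t = torusPush (D.invFun t) := rfl

/-- The tube extension in exponential coordinates. [folklore] -/
theorem torusExtendTube_toFun_expT (t : ℝ) {v : 𝔼 3} (hv : ∀ j, |v j| < π) :
    (D.torusExtendTube hR hR0 hfix hper hball).toFun t (expT v) = expT (D.toFun t v) :=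
  torusPush_expT _ hv

/-- The inverse stages of the tube extension in exponential coordinates. [folklore] -/
theorem torusExtendTube_invFun_expT (t : ℝ) {v : 𝔼 3} (hv : ∀ j, |v j| < π) :
    (D.torusExtendTube hR hR0 hfix hper hball).invFun t (expT v) = expT (D.invFun t v) :=
  torusPush_expT _ hv

/-- **Inverse stages of a stagewise composition**: `((D.trans D') _t)⁻¹ = D_t⁻¹ ∘ D'_t⁻¹`. [folklore] -/
theorem trans_invFun {EN HN : Type*} [NormedAddCommGroup EN] [NormedSpace ℝ EN]
    [TopologicalSpace HN] {J : ModelWithCorners ℝ EN HN} {N : Type*} [TopologicalSpace N]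
    [ChartedSpace HN N] (D₁ D₂ : Diffeotopy J N) (t : ℝ) :
    (D₁.trans D₂).invFun t = D₁.invFun t ∘ D₂.invFun t := by
  funext y
  apply (D₁.trans D₂).toFun_injective t
  rw [(D₁.trans D₂).toFun_invFun, trans_toFun, comp_apply, comp_apply, D₁.toFun_invFun,
    D₂.toFun_invFun]

end Diffeotopy

end TubePush

/-! ### The axis rotation family on `ℝ³` -/

section AxisRot

/-- **Rotation of the `(v₁, v₂)`-plane by the angle `θ`**, fixing the axis coordinate `v₀`. [folklore] -/
def tubeRot (θ : ℝ) (v : 𝔼 3) : 𝔼 3 :=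
  WithLp.toLp 2 ![v 0, Real.cos θ * v 1 - Real.sin θ * v 2, Real.sin θ * v 1 + Real.cos θ * v 2]

/-- The axis coordinate is fixed. [folklore] -/
@[simp] theorem tubeRot_apply_zero (θ : ℝ) (v : 𝔼 3) : tubeRot θ v 0 = v 0 := by
  simp [tubeRot]

/-- First normal coordinate of the rotation. [folklore] -/
@[simp] theorem tubeRot_apply_one (θ : ℝ) (v : 𝔼 3) :
    tubeRot θ v 1 = Real.cos θ * v 1 - Real.sin θ * v 2 := by
  simp [tubeRot]

/-- Second normal coordinate of the rotation. [folklore] -/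
@[simp] theorem tubeRot_apply_two (θ : ℝ) (v : 𝔼 3) :
    tubeRot θ v 2 = Real.sin θ * v 1 + Real.cos θ * v 2 := by
  simp [tubeRot]

/-- The rotation preserves `v₁² + v₂²`. [folklore] -/
theorem sq_add_sq_tubeRot (θ : ℝ) (v : 𝔼 3) :
    (tubeRot θ v) 1 ^ 2 + (tubeRot θ v) 2 ^ 2 = v 1 ^ 2 + v 2 ^ 2 := by
  rw [tubeRot_apply_one, tubeRot_apply_two]
  nlinarith [Real.cos_sq_add_sin_sq θ]

/-- The rotation is an isometry. [folklore] -/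
theorem norm_tubeRot (θ : ℝ) (v : 𝔼 3) : ‖tubeRot θ v‖ = ‖v‖ := by
  have h := sq_add_sq_tubeRot θ v
  rw [EuclideanSpace.norm_eq, EuclideanSpace.norm_eq, Fin.sum_univ_three, Fin.sum_univ_three]
  simp only [Real.norm_eq_abs, sq_abs, tubeRot_apply_zero]
  rw [add_assoc, add_assoc, h]

/-- Rotation by `0` is the identity. [folklore] -/
@[simp] theorem tubeRot_zero (v : 𝔼 3) : tubeRot 0 v = v := by
  ext j
  fin_cases j <;> simp [tubeRot]

/-- Rotation by `2π` is the identity. [folklore] -/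
@[simp] theorem tubeRot_two_pi (v : 𝔼 3) : tubeRot (2 * π) v = v := by
  ext j
  fin_cases j <;> simp [tubeRot]

/-- Rotating back: `Rₓ(-θ) (Rₓ(θ) v) = v`. [folklore] -/
theorem tubeRot_neg_tubeRot (θ : ℝ) (v : 𝔼 3) : tubeRot (-θ) (tubeRot θ v) = v := by
  ext j
  fin_cases j
  · simp
  · change tubeRot (-θ) (tubeRot θ v) 1 = v 1
    rw [tubeRot_apply_one, tubeRot_apply_one, tubeRot_apply_two, Real.cos_neg, Real.sin_neg]
    linear_combination (v 1) * Real.cos_sq_add_sin_sq θ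
  · change tubeRot (-θ) (tubeRot θ v) 2 = v 2
    rw [tubeRot_apply_two, tubeRot_apply_one, tubeRot_apply_two, Real.cos_neg, Real.sin_neg]
    linear_combination (v 2) * Real.cos_sq_add_sin_sq θ

/-- `Rₓ(θ) (Rₓ(-θ) v) = v`. [folklore] -/
theorem tubeRot_tubeRot_neg (θ : ℝ) (v : 𝔼 3) : tubeRot θ (tubeRot (-θ) v) = v := by
  simpa using tubeRot_neg_tubeRot (-θ) v

/-- The rotation commutes with the translations along the axis. [folklore] -/
theorem tubeRot_add_smul_axisVec (θ : ℝ) (v : 𝔼 3) (c : ℝ) :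
    tubeRot θ (v + c • axisVec) = tubeRot θ v + c • axisVec := by
  ext j
  fin_cases j <;> simp [tubeRot, axisVec]

/-- **The rotation is the linear map `rotX`.** [folklore] -/
theorem tubeRot_eq_mulVecE (θ : ℝ) (v : 𝔼 3) :
    tubeRot θ v = mulVecE (rotX (Real.cos θ) (Real.sin θ)) v := by
  ext j
  rw [mulVecE_apply, Fin.sum_univ_three]
  fin_cases j
  · simp [tubeRot, rotX]
  · simp [tubeRot, rotX]; ring
  · simp [tubeRot, rotX]

/-- **The bump of the tube**: `1` where `v₁² + v₂² ≤ 1/4`, `0` where `v₁² + v₂² ≥ 1/2`. [folklore] -/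
def axisBump (v : 𝔼 3) : ℝ := 1 - Real.smoothTransition (4 * (v 1 ^ 2 + v 2 ^ 2) - 1)

/-- Near the axis the bump is `1`. [folklore] -/
theorem axisBump_of_le {v : 𝔼 3} (hv : v 1 ^ 2 + v 2 ^ 2 ≤ 1 / 4) : axisBump v = 1 := by
  rw [axisBump, Real.smoothTransition.zero_of_nonpos (by linarith), sub_zero]

/-- Off the tube the bump is `0`. [folklore] -/
theorem axisBump_of_half_le {v : 𝔼 3} (hv : 1 / 2 ≤ v 1 ^ 2 + v 2 ^ 2) : axisBump v = 0 := by
  rw [axisBump, Real.smoothTransition.one_of_one_le (by linarith), sub_self]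

/-- The bump only depends on `v₁² + v₂²`: it is rotation invariant. [folklore] -/
theorem axisBump_tubeRot (θ : ℝ) (v : 𝔼 3) : axisBump (tubeRot θ v) = axisBump v := by
  rw [axisBump, axisBump, sq_add_sq_tubeRot]

/-- The bump is invariant under the translations along the axis. [folklore] -/
theorem axisBump_add_smul_axisVec (v : 𝔼 3) (c : ℝ) : axisBump (v + c • axisVec) = axisBump v := by
  simp [axisBump, axisVec]

/-- **The angle of the axis twist** at time `t`: `2π λ(t) χ(v)`. [folklore] -/
def axisAngle (t : ℝ) (v : 𝔼 3) : ℝ := 2 * π * Real.smoothTransition t * axisBump v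

/-- **The axis twist on `ℝ³`**: rotate the normal plane of the axis by `axisAngle t v`. [cite: GompfAGT2010, §4 ¶3 (the isotopies differ by a full twist in the normal bundle of the curve)] -/
def axisRotFun (t : ℝ) (v : 𝔼 3) : 𝔼 3 := tubeRot (axisAngle t v) v

/-- The inverse of the axis twist: rotate back by the same angle (the angle is rotation
invariant). [folklore] -/
def axisRotInv (t : ℝ) (v : 𝔼 3) : 𝔼 3 := tubeRot (-axisAngle t v) v

/-- The angle is rotation invariant. [folklore] -/
theorem axisAngle_tubeRot (t θ : ℝ) (v : 𝔼 3) : axisAngle t (tubeRot θ v) = axisAngle t v := by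
  rw [axisAngle, axisAngle, axisBump_tubeRot]

/-- `axisRotInv t ∘ axisRotFun t = id`. [folklore] -/
theorem axisRotInv_axisRotFun (t : ℝ) (v : 𝔼 3) : axisRotInv t (axisRotFun t v) = v := by
  rw [axisRotInv, axisRotFun, axisAngle_tubeRot, tubeRot_neg_tubeRot]

/-- `axisRotFun t ∘ axisRotInv t = id`. [folklore] -/
theorem axisRotFun_axisRotInv (t : ℝ) (v : 𝔼 3) : axisRotFun t (axisRotInv t v) = v := by
  rw [axisRotInv, axisRotFun, axisAngle_tubeRot, tubeRot_tubeRot_neg]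

/-- At `t = 0` the axis twist is the identity. [folklore] -/
@[simp] theorem axisRotFun_zero : axisRotFun 0 = id := by
  funext v
  simp [axisRotFun, axisAngle]

/-- Off the tube `v₁² + v₂² ≥ 1/2` the axis twist is the identity at all times. [folklore] -/
theorem axisRotFun_of_half_le (t : ℝ) {v : 𝔼 3} (hv : 1 / 2 ≤ v 1 ^ 2 + v 2 ^ 2) :
    axisRotFun t v = v := by
  rw [axisRotFun, axisAngle, axisBump_of_half_le hv, mul_zero, tubeRot_zero]

/-- **Near the axis the twist is the rotation `Rₓ(2π λ(t))`.** [folklore] -/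
theorem axisRotFun_of_le (t : ℝ) {v : 𝔼 3} (hv : v 1 ^ 2 + v 2 ^ 2 ≤ 1 / 4) :
    axisRotFun t v = mulVecE (rotX (Real.cos (2 * π * Real.smoothTransition t))
      (Real.sin (2 * π * Real.smoothTransition t))) v := by
  rw [axisRotFun, axisAngle, axisBump_of_le hv, mul_one, tubeRot_eq_mulVecE]

/-- Near the axis the inverse twist is the rotation `Rₓ(-2π λ(t))`. [folklore] -/
theorem axisRotInv_of_le (t : ℝ) {v : 𝔼 3} (hv : v 1 ^ 2 + v 2 ^ 2 ≤ 1 / 4) :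
    axisRotInv t v = mulVecE (rotX (Real.cos (2 * π * Real.smoothTransition t))
      (-Real.sin (2 * π * Real.smoothTransition t))) v := by
  rw [axisRotInv, axisAngle, axisBump_of_le hv, mul_one, tubeRot_eq_mulVecE, Real.cos_neg,
    Real.sin_neg]

/-- **At `t = 1` the twist is the identity near the axis** (a full turn). [folklore] -/
theorem axisRotFun_one_of_le {v : 𝔼 3} (hv : v 1 ^ 2 + v 2 ^ 2 ≤ 1 / 4) : axisRotFun 1 v = v := by
  rw [axisRotFun, axisAngle, axisBump_of_le hv, Real.smoothTransition.one, mul_one, mul_one,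
    tubeRot_two_pi]

/-- The axis twist preserves `v₁² + v₂²`. [folklore] -/
theorem sq_add_sq_axisRotFun (t : ℝ) (v : 𝔼 3) :
    (axisRotFun t v) 1 ^ 2 + (axisRotFun t v) 2 ^ 2 = v 1 ^ 2 + v 2 ^ 2 :=
  sq_add_sq_tubeRot _ _

/-- The axis twist commutes with the translations along the axis. [folklore] -/
theorem axisRotFun_add_smul_axisVec (t : ℝ) (v : 𝔼 3) (c : ℝ) :
    axisRotFun t (v + c • axisVec) = axisRotFun t v + c • axisVec := by
  rw [axisRotFun, axisRotFun, axisAngle, axisBump_add_smul_axisVec, tubeRot_add_smul_axisVec, axisAngle]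

/-- The axis twist fixes `0`. [folklore] -/
@[simp] theorem axisRotFun_apply_zero (t : ℝ) : axisRotFun t 0 = 0 := by
  ext j
  fin_cases j <;> simp [axisRotFun, tubeRot]

/-- Coordinates of `𝔼 3` are smooth. [folklore] -/
theorem contDiff_euclideanThree_apply (i : Fin 3) : ContDiff ℝ ∞ fun v : 𝔼 3 ↦ v i :=
  (EuclideanSpace.proj (𝕜 := ℝ) i).contDiff

/-- The angle is jointly smooth. [folklore] -/
theorem contDiff_axisAngle_uncurry : ContDiff ℝ ∞ fun p : ℝ × 𝔼 3 ↦ axisAngle p.1 p.2 := by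
  unfold axisAngle axisBump
  have h1 : ContDiff ℝ ∞ fun p : ℝ × 𝔼 3 ↦ p.2 1 := (contDiff_euclideanThree_apply 1).comp contDiff_snd
  have h2 : ContDiff ℝ ∞ fun p : ℝ × 𝔼 3 ↦ p.2 2 := (contDiff_euclideanThree_apply 2).comp contDiff_snd
  have hb : ContDiff ℝ ∞ fun p : ℝ × 𝔼 3 ↦
      1 - Real.smoothTransition (4 * (p.2 1 ^ 2 + p.2 2 ^ 2) - 1) :=
    contDiff_const.sub (Real.smoothTransition.contDiff.comp
      ((contDiff_const.mul ((h1.pow 2).add (h2.pow 2))).sub contDiff_const))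
  exact (contDiff_const.mul (Real.smoothTransition.contDiff.comp contDiff_fst)).mul hb

/-- A rotation by a jointly smooth angle is jointly smooth. [folklore] -/
theorem contDiff_tubeRot_of {a : ℝ × 𝔼 3 → ℝ} (ha : ContDiff ℝ ∞ a) :
    ContDiff ℝ ∞ fun p : ℝ × 𝔼 3 ↦ tubeRot (a p) p.2 := by
  have h0 : ContDiff ℝ ∞ fun p : ℝ × 𝔼 3 ↦ p.2 0 := (contDiff_euclideanThree_apply 0).comp contDiff_snd
  have h1 : ContDiff ℝ ∞ fun p : ℝ × 𝔼 3 ↦ p.2 1 := (contDiff_euclideanThree_apply 1).comp contDiff_snd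
  have h2 : ContDiff ℝ ∞ fun p : ℝ × 𝔼 3 ↦ p.2 2 := (contDiff_euclideanThree_apply 2).comp contDiff_snd
  have hc : ContDiff ℝ ∞ fun p : ℝ × 𝔼 3 ↦ Real.cos (a p) := Real.contDiff_cos.comp ha
  have hs : ContDiff ℝ ∞ fun p : ℝ × 𝔼 3 ↦ Real.sin (a p) := Real.contDiff_sin.comp ha
  refine contDiff_euclidean.2 fun i ↦ ?_
  fin_cases i
  · simpa [tubeRot] using h0
  · simpa [tubeRot] using (hc.mul h1).sub (hs.mul h2)
  · simpa [tubeRot] using (hs.mul h1).add (hc.mul h2)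

/-- **The axis twist is jointly smooth.** [folklore] -/
theorem contDiff_axisRotFun_uncurry : ContDiff ℝ ∞ (uncurry axisRotFun) :=
  contDiff_tubeRot_of contDiff_axisAngle_uncurry

/-- The inverse axis twist is jointly smooth. [folklore] -/
theorem contDiff_axisRotInv_uncurry : ContDiff ℝ ∞ (uncurry axisRotInv) :=
  contDiff_tubeRot_of contDiff_axisAngle_uncurry.neg

/-- **The axis twist as a diffeotopy of `ℝ³`.** [cite: GompfAGT2010, §4 ¶3 (the isotopies differ by a full twist in the normal bundle of the curve)] -/
def axisRotDiffeotopy : Diffeotopy 𝓘(ℝ, 𝔼 3) (𝔼 3) :=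
  Diffeotopy.mk' 𝓘(ℝ, 𝔼 3) axisRotFun axisRotInv
    (contMDiff_real_prod_of_contDiff contDiff_axisRotFun_uncurry)
    (contMDiff_real_prod_of_contDiff contDiff_axisRotInv_uncurry)
    axisRotInv_axisRotFun axisRotFun_axisRotInv axisRotFun_zero

/-- Stages of the axis twist of `ℝ³` (definitional). [folklore] -/
@[simp] theorem axisRotDiffeotopy_toFun : axisRotDiffeotopy.toFun = axisRotFun := rfl

/-- Inverse stages of the axis twist of `ℝ³` (definitional). [folklore] -/
@[simp] theorem axisRotDiffeotopy_invFun : axisRotDiffeotopy.invFun = axisRotInv := rfl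

/-- `1 < π`. [folklore] -/
theorem one_lt_pi' : (1 : ℝ) < π := by linarith [Real.pi_gt_three]

/-- **The axis twist of `T³`**: the tube extension of the axis twist of `ℝ³` (tube radius `1`). [cite: GompfAGT2010, §4 ¶3 (the isotopies differ by a full twist in the normal bundle of the curve)] -/
def axisTwistDiffeotopy : Diffeotopy 𝓣 ThreeTorus :=
  axisRotDiffeotopy.torusExtendTube (R := 1) one_lt_pi' one_pos
    (fun t v hv ↦ axisRotFun_of_half_le t (by linarith))
    (fun t v c ↦ axisRotFun_add_smul_axisVec t v c)
    (fun t v hv ↦ by rw [axisRotDiffeotopy_toFun, sq_add_sq_axisRotFun]; exact hv)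

/-- Every stage of the axis twist fixes the base point. [folklore] -/
theorem axisTwistDiffeotopy_based (t : ℝ) : axisTwistDiffeotopy.toFun t 1 = 1 :=
  torusPush_one (axisRotFun_apply_zero t)

/-- The axis twist in exponential coordinates. [folklore] -/
theorem axisTwistDiffeotopy_toFun_expT (t : ℝ) {v : 𝔼 3} (hv : ∀ j, |v j| < π) :
    axisTwistDiffeotopy.toFun t (expT v) = expT (axisRotFun t v) :=
  torusPush_expT _ hv

/-- The inverse axis twist in exponential coordinates. [folklore] -/
theorem axisTwistDiffeotopy_invFun_expT (t : ℝ) {v : 𝔼 3} (hv : ∀ j, |v j| < π) :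
    axisTwistDiffeotopy.invFun t (expT v) = expT (axisRotInv t v) :=
  torusPush_expT _ hv

end AxisRot

/-! ### Reparametrising and twisting a straightening -/

namespace Straightening

variable {A : Matrix.SpecialLinearGroup (Fin 3) ℤ} (S : Straightening A)

/-- **Time reparametrisation of a straightening** by `λ = Real.smoothTransition` (stationary for
`t ≤ 0` and `t ≥ 1`; in particular all linear parts lie on the compact arc `t ∈ [0, 1]`). [cite: GompfAGT2010, Def. 4.1 and §4 ¶2 (X^σ depends only on the straightening class σ)] -/
def reparam : Straightening A where
  D := S.D.reparam Real.smoothTransition Real.smoothTransition.contDiff Real.smoothTransition.zero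
  based t := by rw [Diffeotopy.reparam_toFun]; exact S.based _
  G t := S.G (Real.smoothTransition t)
  Ginv t := S.Ginv (Real.smoothTransition t)
  contDiff_G i j := (S.contDiff_G i j).comp Real.smoothTransition.contDiff
  contDiff_Ginv i j := (S.contDiff_Ginv i j).comp Real.smoothTransition.contDiff
  G_mul_Ginv t := S.G_mul_Ginv _
  Ginv_mul_G t := S.Ginv_mul_G _
  G_zero := by rw [Real.smoothTransition.zero, S.G_zero]
  G_one := by rw [Real.smoothTransition.one, S.G_one]
  R := S.R
  R_pos := S.R_pos
  toFun_expT t v hv := by rw [Diffeotopy.reparam_toFun]; exact S.toFun_expT _ v hv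
  invFun_expT t v hv := by rw [Diffeotopy.reparam_invFun]; exact S.invFun_expT _ v hv

/-- Linear parts of the reparametrised straightening (definitional). [folklore] -/
@[simp] theorem reparam_G (t : ℝ) : S.reparam.G t = S.G (Real.smoothTransition t) := rfl

/-- Inverse linear parts of the reparametrised straightening (definitional). [folklore] -/
@[simp] theorem reparam_Ginv (t : ℝ) : S.reparam.Ginv t = S.Ginv (Real.smoothTransition t) := rfl

/-- The framing path of the reparametrised straightening. [folklore] -/
theorem reparam_path_toFun (θ : ℝ) :
    S.reparam.path.toFun θ = S.G (Real.smoothTransition (isotopyProfile (θ / 2))) * slRealMatrix A :=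
  rfl

/-- **A uniform bound for the inverse linear parts on `[0, 1]`** (continuity on a compact
interval). [folklore] -/
theorem exists_abs_Ginv_le : ∃ K : ℝ, 1 ≤ K ∧ ∀ t ∈ Icc (0 : ℝ) 1, ∀ i j, |S.Ginv t i j| ≤ K := by
  have h : ∀ i j : Fin 3, ∃ C, ∀ t ∈ Icc (0 : ℝ) 1, ‖S.Ginv t i j‖ ≤ C := fun i j ↦
    isCompact_Icc.exists_bound_of_continuousOn (S.contDiff_Ginv i j).continuous.continuousOn
  choose C hC using h
  refine ⟨1 + ∑ i, ∑ j, |C i j|, by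
    have : 0 ≤ ∑ i, ∑ j, |C i j| := Finset.sum_nonneg fun i _ ↦ Finset.sum_nonneg fun j _ ↦ abs_nonneg _
    linarith, fun t ht i j ↦ ?_⟩
  have h1 : |S.Ginv t i j| ≤ |C i j| := ((Real.norm_eq_abs _).symm.le.trans (hC i j t ht)).trans (le_abs_self _)
  have h2 : |C i j| ≤ ∑ i, ∑ j, |C i j| :=
    (Finset.single_le_sum (f := fun j ↦ |C i j|) (fun _ _ ↦ abs_nonneg _) (Finset.mem_univ j)).trans
      (Finset.single_le_sum (f := fun i ↦ ∑ j, |C i j|)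
        (fun _ _ ↦ Finset.sum_nonneg fun _ _ ↦ abs_nonneg _) (Finset.mem_univ i))
  linarith

/-- The bound `K ≥ 1` for the inverse linear parts on `[0, 1]`. [folklore] -/
def invBound : ℝ := S.exists_abs_Ginv_le.choose

/-- `1 ≤ K`. [folklore] -/
theorem one_le_invBound : 1 ≤ S.invBound := S.exists_abs_Ginv_le.choose_spec.1

/-- `|G_t⁻¹ᵢⱼ| ≤ K` for `t ∈ [0, 1]`. [folklore] -/
theorem abs_Ginv_le_invBound {t : ℝ} (ht : t ∈ Icc (0 : ℝ) 1) (i j : Fin 3) :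
    |S.Ginv t i j| ≤ S.invBound :=
  S.exists_abs_Ginv_le.choose_spec.2 t ht i j

/-- **The cube of the axis twist**: half-width `min (R/2) (1/(24 K))`. [folklore] -/
def twistRad : ℝ := min (S.R / 2) (1 / (24 * S.invBound))

/-- The half-width is positive. [folklore] -/
theorem twistRad_pos : 0 < S.twistRad :=
  lt_min (half_pos S.R_pos) (by have := S.one_le_invBound; positivity)

/-- `2 · twistRad ≤ R`. [folklore] -/
theorem two_mul_twistRad_le_R : 2 * S.twistRad ≤ S.R := by
  have := min_le_left (S.R / 2) (1 / (24 * S.invBound)); unfold twistRad; linarith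

/-- `twistRad ≤ 1/(24 K)`. [folklore] -/
theorem twistRad_le : S.twistRad ≤ 1 / (24 * S.invBound) := min_le_right _ _

/-- `2 · twistRad ≤ 1/12`. [folklore] -/
theorem two_mul_twistRad_le : 2 * S.twistRad ≤ 1 / 12 := by
  have h1 := S.twistRad_le
  have hK := S.one_le_invBound
  have : 1 / (24 * S.invBound) ≤ 1 / 24 :=
    one_div_le_one_div_of_le (by norm_num) (by linarith)
  linarith

/-- The rotation matrix of the twist at time `t`. [folklore] -/
def rotXMat (t : ℝ) : Matrix (Fin 3) (Fin 3) ℝ :=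
  rotX (Real.cos (2 * π * Real.smoothTransition t)) (Real.sin (2 * π * Real.smoothTransition t))

/-- Its inverse. [folklore] -/
def rotXMatInv (t : ℝ) : Matrix (Fin 3) (Fin 3) ℝ :=
  rotX (Real.cos (2 * π * Real.smoothTransition t)) (-Real.sin (2 * π * Real.smoothTransition t))

/-- `R_t R_t⁻¹ = 1`. [folklore] -/
theorem rotXMat_mul_rotXMatInv (t : ℝ) : rotXMat t * rotXMatInv t = 1 :=
  rotX_mul_rotX_neg (Real.cos_sq_add_sin_sq _)

/-- `R_t⁻¹ R_t = 1`. [folklore] -/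
theorem rotXMatInv_mul_rotXMat (t : ℝ) : rotXMatInv t * rotXMat t = 1 := by
  have h := rotX_mul_rotX_neg (c := Real.cos (2 * π * Real.smoothTransition t))
    (s := -Real.sin (2 * π * Real.smoothTransition t)) (by rw [neg_sq]; exact Real.cos_sq_add_sin_sq _)
  rwa [neg_neg] at h

/-- `R_0 = 1`. [folklore] -/
theorem rotXMat_zero : rotXMat 0 = 1 := by
  rw [rotXMat, Real.smoothTransition.zero, mul_zero, Real.cos_zero, Real.sin_zero]
  exact rotX_one_zero'

/-- `R_1 = Rₓ(2π) = 1`. [folklore] -/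
theorem rotXMat_one : rotXMat 1 = 1 := by
  rw [rotXMat, Real.smoothTransition.one, mul_one, Real.cos_two_pi, Real.sin_two_pi]
  exact rotX_one_zero'

/-- Entries of `R_t` are smooth. [folklore] -/
theorem contDiff_rotXMat_apply (i j : Fin 3) : ContDiff ℝ ∞ fun t ↦ rotXMat t i j := by
  fin_cases i <;> fin_cases j <;> simp [rotXMat, rotX] <;> fun_prop

/-- Entries of `R_t⁻¹` are smooth. [folklore] -/
theorem contDiff_rotXMatInv_apply (i j : Fin 3) : ContDiff ℝ ∞ fun t ↦ rotXMatInv t i j := by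
  fin_cases i <;> fin_cases j <;> simp [rotXMatInv, rotX] <;> fun_prop

/-- Vectors in the cube of half-width `twistRad` are short. [folklore] -/
theorem norm_lt_of_abs_lt_twistRad {v : 𝔼 3} (hv : ∀ i, |v i| < S.twistRad) : ‖v‖ < 1 / 12 :=
  (norm_lt_two_mul_of_abs_lt hv).trans_le S.two_mul_twistRad_le

/-- Vectors of norm `< 1/12` are well inside the tube `v₁² + v₂² ≤ 1/4`. [folklore] -/
theorem sq_add_sq_le_of_norm_lt {v : 𝔼 3} (hv : ‖v‖ < 1 / 12) : v 1 ^ 2 + v 2 ^ 2 ≤ 1 / 4 := by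
  have h1 : |v 1| ≤ ‖v‖ := (Real.norm_eq_abs _).symm.le.trans (PiLp.norm_apply_le v 1)
  have h2 : |v 2| ≤ ‖v‖ := (Real.norm_eq_abs _).symm.le.trans (PiLp.norm_apply_le v 2)
  nlinarith [abs_nonneg (v 1), abs_nonneg (v 2), sq_abs (v 1), sq_abs (v 2), norm_nonneg v]

/-- Vectors of norm `< 1/12` lie in the open cube of half-width `π`. [folklore] -/
theorem abs_lt_pi_of_norm_lt {v : 𝔼 3} (hv : ‖v‖ < 1 / 12) (j : Fin 3) : |v j| < π :=
  ((Real.norm_eq_abs _).symm.le.trans (PiLp.norm_apply_le v j)).trans_lt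
    (hv.trans (by linarith [Real.pi_gt_three]))

/-- **The inverse linear parts keep the cube inside the tube**: for `|vᵢ| < twistRad` and
`t ∈ [0, 1]`, `‖G_t⁻¹ v‖`-coordinates are `< 1/4`. [folklore] -/
theorem abs_Ginv_mulVecE_lt {t : ℝ} (ht : t ∈ Icc (0 : ℝ) 1) {v : 𝔼 3} (hv : ∀ i, |v i| < S.twistRad)
    (i : Fin 3) : |mulVecE (S.Ginv t) v i| < 1 / 4 := by
  have hK := S.one_le_invBound
  have h1 : |mulVecE (S.Ginv t) v i| ≤ 3 * S.invBound * ‖v‖ := by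
    simpa using abs_mulVecE_apply_le (fun i j ↦ S.abs_Ginv_le_invBound ht i j) v i
  have h2 : ‖v‖ < 2 * S.twistRad := norm_lt_two_mul_of_abs_lt hv
  have h3 : 2 * S.twistRad ≤ 2 * (1 / (24 * S.invBound)) := by linarith [S.twistRad_le]
  have h4 : 3 * S.invBound * (2 * (1 / (24 * S.invBound))) = 1 / 4 := by
    field_simp
    norm_num
  calc |mulVecE (S.Ginv t) v i| ≤ 3 * S.invBound * ‖v‖ := h1
    _ < 3 * S.invBound * (2 * S.twistRad) := mul_lt_mul_of_pos_left h2 (by positivity)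
    _ ≤ 3 * S.invBound * (2 * (1 / (24 * S.invBound))) := mul_le_mul_of_nonneg_left h3 (by positivity)
    _ = 1 / 4 := h4

/-- **The axis twist of a straightening.** Precompose the reparametrised diffeotopy of `S` with the
axis twist of `T³`: again a based diffeotopy with exactly linear germs, the linear parts being
`G_{λ(t)} · Rₓ(2π λ(t))` (from `1` at `t = 0` to `A⁻¹ · Rₓ(2π) = A⁻¹` at `t = 1`). Gompf, §4 after
Def. 4.1 and ¶3: the second straightening differs from the first "by a full twist in the normal
bundle of the curve". [cite: GompfAGT2010, §4 ¶3 (the isotopies differ by a full twist in the normal bundle of the curve)] -/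
def axisTwist : Straightening A where
  D := axisTwistDiffeotopy.trans S.reparam.D
  based t := by
    rw [Diffeotopy.trans_toFun, comp_apply, axisTwistDiffeotopy_based]
    exact S.reparam.based t
  G t := S.G (Real.smoothTransition t) * rotXMat t
  Ginv t := rotXMatInv t * S.Ginv (Real.smoothTransition t)
  contDiff_G := SmoothMatrixPath.contDiff_mul_apply
    (fun i j ↦ (S.contDiff_G i j).comp Real.smoothTransition.contDiff) contDiff_rotXMat_apply
  contDiff_Ginv := SmoothMatrixPath.contDiff_mul_apply contDiff_rotXMatInv_apply
    fun i j ↦ (S.contDiff_Ginv i j).comp Real.smoothTransition.contDiff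
  G_mul_Ginv t := by
    calc S.G (Real.smoothTransition t) * rotXMat t * (rotXMatInv t * S.Ginv (Real.smoothTransition t))
        = S.G (Real.smoothTransition t) * (rotXMat t * rotXMatInv t) * S.Ginv (Real.smoothTransition t) := by
          simp only [Matrix.mul_assoc]
      _ = 1 := by rw [rotXMat_mul_rotXMatInv, Matrix.mul_one, S.G_mul_Ginv]
  Ginv_mul_G t := by
    calc rotXMatInv t * S.Ginv (Real.smoothTransition t) * (S.G (Real.smoothTransition t) * rotXMat t)
        = rotXMatInv t * (S.Ginv (Real.smoothTransition t) * S.G (Real.smoothTransition t)) * rotXMat t := by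
          simp only [Matrix.mul_assoc]
      _ = 1 := by rw [S.Ginv_mul_G, Matrix.mul_one, rotXMatInv_mul_rotXMat]
  G_zero := by rw [Real.smoothTransition.zero, S.G_zero, rotXMat_zero, Matrix.one_mul]
  G_one := by rw [Real.smoothTransition.one, S.G_one, rotXMat_one, Matrix.mul_one]
  R := S.twistRad
  R_pos := S.twistRad_pos
  toFun_expT t v hv := by
    have hn := S.norm_lt_of_abs_lt_twistRad hv
    have hW : axisTwistDiffeotopy.toFun t (expT v) = expT (mulVecE (rotXMat t) v) := by
      rw [axisTwistDiffeotopy_toFun_expT t (abs_lt_pi_of_norm_lt hn),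
        axisRotFun_of_le t (sq_add_sq_le_of_norm_lt hn)]
      rfl
    have hrot : ∀ i, |mulVecE (rotXMat t) v i| < S.R := fun i ↦ by
      have h1 : |mulVecE (rotXMat t) v i| ≤ ‖mulVecE (rotXMat t) v‖ :=
        (Real.norm_eq_abs _).symm.le.trans (PiLp.norm_apply_le _ i)
      have h2 : ‖mulVecE (rotXMat t) v‖ = ‖v‖ := by
        rw [rotXMat, ← tubeRot_eq_mulVecE, norm_tubeRot]
      exact h1.trans_lt (h2 ▸ (norm_lt_two_mul_of_abs_lt hv).trans_le S.two_mul_twistRad_le_R)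
    rw [Diffeotopy.trans_toFun, comp_apply, hW]
    show S.reparam.D.toFun t (expT (mulVecE (rotXMat t) v)) = _
    rw [S.reparam.toFun_expT t _ hrot, reparam_G, mulVecE_mulVecE]
  invFun_expT t v hv := by
    have hv' : ∀ i, |v i| < S.R := fun i ↦ (hv i).trans_le (by
      have := S.two_mul_twistRad_le_R; have := S.twistRad_pos; linarith)
    have hG : ∀ i, |mulVecE (S.Ginv (Real.smoothTransition t)) v i| < 1 / 4 :=
      S.abs_Ginv_mulVecE_lt ⟨Real.smoothTransition.nonneg t, Real.smoothTransition.le_one t⟩ hv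
    have hGπ : ∀ i, |mulVecE (S.Ginv (Real.smoothTransition t)) v i| < π := fun i ↦
      (hG i).trans (by linarith [Real.pi_gt_three])
    have hGsq : (mulVecE (S.Ginv (Real.smoothTransition t)) v) 1 ^ 2 +
        (mulVecE (S.Ginv (Real.smoothTransition t)) v) 2 ^ 2 ≤ 1 / 4 := by
      have h1 := abs_lt.1 (hG 1)
      have h2 := abs_lt.1 (hG 2)
      nlinarith
    rw [Diffeotopy.trans_invFun, comp_apply]
    show axisTwistDiffeotopy.invFun t (S.reparam.D.invFun t (expT v)) = _
    rw [S.reparam.invFun_expT t v hv', reparam_Ginv, axisTwistDiffeotopy_invFun_expT t hGπ]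
    show expT (axisRotInv t (mulVecE (S.Ginv (Real.smoothTransition t)) v)) = _
    rw [axisRotInv_of_le t hGsq, mulVecE_mulVecE]
    rfl

/-- Linear parts of the axis twist (definitional). [folklore] -/
@[simp] theorem axisTwist_G (t : ℝ) : S.axisTwist.G t = S.G (Real.smoothTransition t) * rotXMat t := rfl

/-- **The framing path of the axis twist is the framing path of the reparametrised straightening
times the conjugated full turn**: `γ'(θ) = γ(θ) · (A⁻¹ Rₓ(2π μ(θ)) A)` with
`μ(θ) = λ(isotopyProfile(θ/2))`, `μ(0) = 1`, `μ(1) = 0`. [cite: GompfAGT2010, §4 (after Def. 4.1: exactly two straightenings, differing by an element of π₁(GL(V)) = ℤ/2)] -/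
theorem axisTwist_path_toFun (θ : ℝ) :
    S.axisTwist.path.toFun θ = S.reparam.path.toFun θ * (slRealMatrix A⁻¹ *
      rotX (Real.cos (2 * π * Real.smoothTransition (isotopyProfile (θ / 2))))
        (Real.sin (2 * π * Real.smoothTransition (isotopyProfile (θ / 2)))) * slRealMatrix A) := by
  show S.axisTwist.G (isotopyProfile (θ / 2)) * slRealMatrix A =
    S.reparam.G (isotopyProfile (θ / 2)) * slRealMatrix A * _
  rw [axisTwist_G, reparam_G, rotXMat]
  set G := S.G (Real.smoothTransition (isotopyProfile (θ / 2)))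
  set Rm := rotX (Real.cos (2 * π * Real.smoothTransition (isotopyProfile (θ / 2))))
    (Real.sin (2 * π * Real.smoothTransition (isotopyProfile (θ / 2))))
  calc G * Rm * slRealMatrix A
      = G * (slRealMatrix A * slRealMatrix A⁻¹) * Rm * slRealMatrix A := by
        rw [slRealMatrix_mul_inv, Matrix.mul_one]
    _ = G * slRealMatrix A * (slRealMatrix A⁻¹ * Rm * slRealMatrix A) := by
        simp only [Matrix.mul_assoc]

/-- The profile `μ(θ) = λ(isotopyProfile(θ/2))` starts at `1`. [folklore] -/
theorem smoothTransition_isotopyProfile_zero :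
    Real.smoothTransition (isotopyProfile ((0 : ℝ) / 2)) = 1 := by
  rw [zero_div, isotopyProfile_of_le (by norm_num), Real.smoothTransition.one]

/-- The profile `μ(θ) = λ(isotopyProfile(θ/2))` ends at `0`. [folklore] -/
theorem smoothTransition_isotopyProfile_one :
    Real.smoothTransition (isotopyProfile ((1 : ℝ) / 2)) = 0 := by
  rw [isotopyProfile_of_ge (by norm_num), Real.smoothTransition.zero]

/-- The profile is continuous. [folklore] -/
theorem continuous_smoothTransition_isotopyProfile :
    Continuous fun θ : ℝ ↦ Real.smoothTransition (isotopyProfile (θ / 2)) :=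
  Real.smoothTransition.continuous.comp (contDiff_isotopyProfile.continuous.comp
    (continuous_id.div_const _))

/-- **The two classes realised by straightenings**: every smooth framing path `δ` from `1` to `A`
is homotopic rel end points to the framing path of `S.reparam` or to that of `S.axisTwist`
(`SmoothMatrixPath.homotopic_or_homotopic_of_mul_conj_rotX` applied to
`axisTwist_path_toFun`). [cite: GompfAGT2010, §4 (after Def. 4.1: exactly two straightenings, differing by an element of π₁(GL(V)) = ℤ/2)] -/
theorem homotopic_reparam_or_axisTwist (δ : SmoothMatrixPath (slRealMatrix A)) :
    δ.toPath.Homotopic S.reparam.path.toPath ∨ δ.toPath.Homotopic S.axisTwist.path.toPath :=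
  SmoothMatrixPath.homotopic_or_homotopic_of_mul_conj_rotX S.reparam.path S.axisTwist.path
    (fun θ ↦ Real.smoothTransition (isotopyProfile (θ / 2)))
    continuous_smoothTransition_isotopyProfile smoothTransition_isotopyProfile_zero
    smoothTransition_isotopyProfile_one (fun θ ↦ S.axisTwist_path_toFun θ) δ

end Straightening

/-! ### Normal form of all framed spheres -/

section NormalForm

variable (A : Matrix.SpecialLinearGroup (Fin 3) ℤ) (γ : SmoothMatrixPath (slRealMatrix A))

/-- **Every framing path is the path of a straightening with exactly linear germs** (up to
homotopy rel end points): take the linear straightening of `A` (`GompfStraighteningExistence.lean`),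
reparametrised, or its axis twist. [cite: GompfAGT2010, Def. 4.1 and §4 ¶2 (X^σ depends only on the straightening class σ)] -/
theorem exists_straightening_homotopic : ∃ S : Straightening A, γ.toPath.Homotopic S.path.toPath := by
  rcases (linearStraightening A).homotopic_reparam_or_axisTwist γ with h | h
  · exact ⟨_, h⟩
  · exact ⟨_, h⟩

/-- **Normal form of Gompf's framed spheres.** For every `A ∈ SL(3, ℤ)` and every smooth framing
path `γ` from `1` to `A`, the framed sphere `gompfSphere A γ = X^{[γ]}_A` is diffeomorphic to the
product-framed surgery `S.prodSphere` of the mapping torus of a straightened monodromy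
`S.monodromy` (a diffeomorphism of `T³` isotopic to `A`, equal to the identity near the base point,
`Straightening.monodromy_expT`) for some straightening `S` of `A` with exactly linear germs. This is
Gompf's set-up of §2 ¶1 ("we may assume `φ` restricts to the identity in a neighborhood of some
point `p`", with the canonically framed circle `C`) reached from the tree's concrete spheres, for
both straightening classes (§4 ¶2). [cite: GompfAGT2010, §4 ¶2 (X^{τ·σ}_ψ = X^σ_φ)] -/
theorem exists_straightening_nonempty_diffeomorph_prodSphere :
    ∃ S : Straightening A, Nonempty (gompfSphere A γ ≃ₘ⟮𝓡 4, 𝓡 4⟯ S.prodSphere) := by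
  obtain ⟨S, hS⟩ := exists_straightening_homotopic A γ
  exact ⟨S, S.nonempty_diffeomorph_gompfSphere_prodSphere_of_homotopic γ hS⟩

end NormalForm

end Literature.Topology.FourManifolds
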